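import Literature.NumberTheory.LFunctions.ZetaArgHSW
import Literature.NumberTheory.LFunctions.ZetaFirstZeroCertificate
import Literature.NumberTheory.LFunctions.ZetaZerosProofs
import Mathlib.Analysis.SpecialFunctions.Log.NegMulLog
import HarnessLib

/-!
# HANDOFF — the CLEAN HORIZON of the dodger: `N(πk/b) ≤ k − 1` below an undershot horizon (rh-explicit, track «HANDOFF», seat prove-2 gen8, ATTEMPT-16 Lemma B1 (a))

HONEST FRAMING. Nothing here bears on the truth of RH; this is zero COUNTING. In ATTEMPT-16 (HOME/handoff/prove-2/ATTEMPT-16.md §3)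
the dodger kills the first `K` zeros of `ζ` against the lattice `ℓ_k = πk/b` of its window, and the whole proof rests on Lemma B1 (a):
if the horizon is UNDERSHOT — `T* ≤ T₀ − 4π(s+2)` with `T₀ = 2πe^{1+2b}` (the height where the mean zero density equals the lattice
density `b/π`) and `s` a bound for `|N(t) − (t/2π)log(t/2πe)|` below `T₀` — then `N(ℓ_k) ≤ k − 1` for every lattice point `ℓ_k ≤ T*`,
i.e. the `k`-th zero lies strictly above the `k`-th lattice point and every unkilled zero lies above the horizon. The proof is the
identity `bt/π − (t/2π)log(t/2πe) = (t/2π)log(T₀/t) =: f(t)` and the concavity of `f` (`f ≥ min(f(14), f(T*)) ≥ s+1` on `[14, T*]`).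
THIS FILE proves it in the kernel, abstractly in `s` (`zetaZeroCount_lattice_le`) and with the tree's explicit counting theorem
`zetaZeroCount_hasanalizade_shen_wong_holds` (`zetaZeroCount_lattice_le_hsw`). No `sorry`, standard axioms.

References: this track (ATTEMPT-16 §3, Lemma B1). E. Hasanalizade, Q. Shen, P.-J. Wong, J. Number Theory 235 (2022) (the strength of
the counting input; tree `zetaZeroCount_hasanalizade_shen_wong`).
-/

set_option linter.dupNamespace false

open Real Set Literature.NumberTheory.LFunctions

namespace Summit.RiemannHypothesis.RiemannHypothesis.Theorems.Handoff

/-- The deficit function `f(t) = (t/2π)·log(T₀/t)` is `(T₀/2π)·negMulLog(t/T₀)`. [folklore] -/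
theorem deficit_eq_negMulLog {T₀ t : ℝ} (hT₀ : 0 < T₀) (ht : 0 < t) :
    t / (2 * π) * Real.log (T₀ / t) = T₀ / (2 * π) * negMulLog (t / T₀) := by
  rw [negMulLog, Real.log_div hT₀.ne' ht.ne', Real.log_div ht.ne' hT₀.ne']
  field_simp
  ring

/-- Concavity: on `[x, y] ⊆ (0, ∞)`, `f(t) ≥ min(f(x), f(y))` for `f(t) = (t/2π)log(T₀/t)`. [folklore] -/
theorem deficit_ge_min {T₀ x y t : ℝ} (hT₀ : 0 < T₀) (hx : 0 < x) (hxt : x ≤ t) (hty : t ≤ y) :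
    min (x / (2 * π) * Real.log (T₀ / x)) (y / (2 * π) * Real.log (T₀ / y)) ≤ t / (2 * π) * Real.log (T₀ / t) := by
  have ht : 0 < t := lt_of_lt_of_le hx hxt
  have hy : 0 < y := lt_of_lt_of_le ht hty
  rw [deficit_eq_negMulLog hT₀ hx, deficit_eq_negMulLog hT₀ hy, deficit_eq_negMulLog hT₀ ht]
  have hc : 0 < T₀ / (2 * π) := by positivity
  rw [← mul_min_of_nonneg _ _ hc.le]
  refine mul_le_mul_of_nonneg_left ?_ hc.le
  have hseg : t / T₀ ∈ segment ℝ (x / T₀) (y / T₀) := by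
    rw [segment_eq_Icc (div_le_div_of_nonneg_right (hxt.trans hty) hT₀.le)]
    exact ⟨div_le_div_of_nonneg_right hxt hT₀.le, div_le_div_of_nonneg_right hty hT₀.le⟩
  exact concaveOn_negMulLog.ge_on_segment (mem_Ici.2 (by positivity)) (mem_Ici.2 (by positivity)) hseg

/-- The key identity: with `T₀ = 2πe^{1+2b}`, `(t/2π)log(t/(2πe)) = bt/π − (t/2π)log(T₀/t)`. [this track, ATTEMPT-16 §1] -/
theorem main_eq_lattice_sub_deficit {b t : ℝ} (ht : 0 < t) :
    t / (2 * π) * Real.log (t / (2 * π * Real.exp 1)) =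
      b * t / π - t / (2 * π) * Real.log (2 * π * Real.exp (1 + 2 * b) / t) := by
  have hπ : 0 < π := Real.pi_pos
  have h2π : (0 : ℝ) < 2 * π := by positivity
  rw [Real.log_div ht.ne' (by positivity), Real.log_div (by positivity) ht.ne', Real.log_mul h2π.ne' (Real.exp_pos _).ne',
    Real.log_mul h2π.ne' (Real.exp_pos _).ne', Real.log_exp, Real.log_exp]
  field_simp
  ring

/-- **ATTEMPT-16 Lemma B1 (a), abstract form (kernel).** Let `b ≥ 1`, `T₀ = 2πe^{1+2b}`, and suppose
`N(t) ≤ (t/2π)log(t/(2πe)) + s` for `14 ≤ t ≤ T₀` (`s ≥ 0`). If the horizon `T*` satisfies the UNDERSHOOT `T* ≤ T₀ − 4π(s+2)`,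
`T₀ ≤ (11/10)T*`, and `(14/2π)log(T₀/14) ≥ s + 1`, then for every `k ≥ 1` with `πk/b ≤ T*`:  `N(πk/b) ≤ k − 1`.
(So the `k`-th zero ordinate exceeds `ℓ_k = πk/b`, and `N(T*) ≤ K − 1` at `k = K`: every unkilled zero lies above the horizon.)
[this track, ATTEMPT-16 Lemma B1 (a)] -/
theorem zetaZeroCount_lattice_le {b T₀ s Tstar : ℝ} (hb : 1 ≤ b) (hT₀ : T₀ = 2 * π * Real.exp (1 + 2 * b)) (hs0 : 0 ≤ s)
    (hs : ∀ t : ℝ, 14 ≤ t → t ≤ T₀ → (zetaZeroCount t : ℝ) ≤ t / (2 * π) * Real.log (t / (2 * π * Real.exp 1)) + s)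
    (hT1 : Tstar ≤ T₀ - 4 * π * (s + 2)) (hT2 : T₀ ≤ 11 / 10 * Tstar)
    (hQ1b : s + 1 ≤ 14 / (2 * π) * Real.log (T₀ / 14))
    {k : ℕ} (hk : 1 ≤ k) (hkT : π * k / b ≤ Tstar) :
    (zetaZeroCount (π * k / b) : ℝ) ≤ k - 1 := by
  have hπ : 0 < π := Real.pi_pos
  have hb0 : 0 < b := by linarith
  have hT₀pos : 0 < T₀ := by rw [hT₀]; positivity
  have hTstar_pos : 0 < Tstar := by nlinarith
  have hTstar_le : Tstar ≤ T₀ := by nlinarith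
  set t : ℝ := π * k / b with ht_def
  have htpos : 0 < t := by positivity
  rcases lt_or_ge t 14 with hlt | hge
  · -- below the first zero
    have h0 : zetaZeroCount t ≤ zetaZeroCount 14 := zetaZeroCount_mono hlt.le
    rw [zetaZeroCount_fourteen] at h0
    have : (zetaZeroCount t : ℝ) = 0 := by exact_mod_cast Nat.le_zero.1 h0
    rw [this]
    have : (1 : ℝ) ≤ k := by exact_mod_cast hk
    linarith
  · -- 14 ≤ t ≤ T* ≤ T₀: counting + concavity of the deficit
    have hN := hs t hge (hkT.trans hTstar_le)
    rw [main_eq_lattice_sub_deficit (b := b) htpos, ← hT₀] at hN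
    have hbt : b * t / π = k := by rw [ht_def]; field_simp
    rw [hbt] at hN
    -- the deficit at t is ≥ min(deficit at 14, deficit at T*) ≥ s + 1
    have hmin := deficit_ge_min hT₀pos (by norm_num : (0 : ℝ) < 14) hge hkT
    have h14 : s + 1 ≤ 14 / (2 * π) * Real.log (T₀ / 14) := hQ1b
    have hTs : s + 1 ≤ Tstar / (2 * π) * Real.log (T₀ / Tstar) := by
      -- log(T₀/T*) ≥ 1 − T*/T₀ ≥ 4π(s+2)/T₀, and T*/T₀ ≥ 10/11
      have hlog : 1 - (T₀ / Tstar)⁻¹ ≤ Real.log (T₀ / Tstar) := Real.one_sub_inv_le_log_of_pos (by positivity)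
      rw [inv_div] at hlog
      have h1 : 1 - Tstar / T₀ ≥ 4 * π * (s + 2) / T₀ := by
        rw [ge_iff_le, div_le_iff₀ hT₀pos, sub_mul, div_mul_cancel₀ _ hT₀pos.ne', one_mul]
        linarith
      have h2 : Tstar / (2 * π) * Real.log (T₀ / Tstar) ≥ Tstar / (2 * π) * (4 * π * (s + 2) / T₀) :=
        mul_le_mul_of_nonneg_left (h1.le.trans hlog) (by positivity)
      have h3 : Tstar / (2 * π) * (4 * π * (s + 2) / T₀) = 2 * (s + 2) * (Tstar / T₀) := by
        field_simp
        ring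
      have h4 : 10 / 11 ≤ Tstar / T₀ := by
        rw [le_div_iff₀ hT₀pos]; linarith
      have h5 : 2 * (s + 2) * (10 / 11) ≤ 2 * (s + 2) * (Tstar / T₀) :=
        mul_le_mul_of_nonneg_left h4 (by linarith)
      linarith [h2, h3.symm.le, h3.le]
    have hdef : s + 1 ≤ t / (2 * π) * Real.log (T₀ / t) := (le_min h14 hTs).trans hmin
    linarith


/-- **ATTEMPT-16 Lemma B1 (b), abstract form (kernel): the top killed zero is below `T_top := T₀ + π(s+1)/b`.** If
`N(t) ≥ (t/2π)log(t/(2πe)) − s` for `T₀ ≤ t ≤ 2T₀` and `π(s+1)/b ≤ T₀`, then `N(T_top) ≥ bT₀/π + 1` (`> K₁` for the undershot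
`K₁ ≤ (b/π)(T₀ − 4π(s+2))`), because the deficit `(t/2π)log(T₀/t)` is `≤ 0` beyond `T₀`. [this track, ATTEMPT-16 Lemma B1 (b)] -/
theorem zetaZeroCount_top_ge {b T₀ s : ℝ} (hb : 1 ≤ b) (hT₀ : T₀ = 2 * π * Real.exp (1 + 2 * b))
    (hs' : ∀ t : ℝ, T₀ ≤ t → t ≤ 2 * T₀ → t / (2 * π) * Real.log (t / (2 * π * Real.exp 1)) - s ≤ (zetaZeroCount t : ℝ))
    (hs0 : 0 ≤ s + 1) (hsmall : π * (s + 1) / b ≤ T₀) :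
    b * T₀ / π + 1 ≤ (zetaZeroCount (T₀ + π * (s + 1) / b) : ℝ) := by
  have hπ : 0 < π := Real.pi_pos
  have hb0 : 0 < b := by linarith
  have hT₀pos : 0 < T₀ := by rw [hT₀]; positivity
  set t : ℝ := T₀ + π * (s + 1) / b with ht_def
  have hinc : 0 ≤ π * (s + 1) / b := div_nonneg (mul_nonneg hπ.le hs0) hb0.le
  have htT₀ : T₀ ≤ t := by rw [ht_def]; linarith
  have htpos : 0 < t := lt_of_lt_of_le hT₀pos htT₀
  have ht2 : t ≤ 2 * T₀ := by rw [ht_def]; linarith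
  have hN := hs' t htT₀ ht2
  rw [main_eq_lattice_sub_deficit (b := b) htpos, ← hT₀] at hN
  -- the deficit is ≤ 0 beyond T₀
  have hdef : t / (2 * π) * Real.log (T₀ / t) ≤ 0 := by
    have hlog : Real.log (T₀ / t) ≤ 0 := Real.log_nonpos (by positivity) ((div_le_one htpos).2 htT₀)
    exact mul_nonpos_of_nonneg_of_nonpos (by positivity) hlog
  have hbt : b * t / π = b * T₀ / π + (s + 1) := by rw [ht_def]; field_simp
  rw [hbt] at hN
  linarith


/-- **ATTEMPT-16 Lemma B1 (c), abstract form (kernel): at most `3s + 5` killed zeros lie above the horizon.** If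
`N(T*) ≥ (T*/2π)log(T*/(2πe)) − s`, `T* = πK/b` and `T* ≥ T₀ − 4π(s+2) − 2π/b` (the floor in `K₁`), `b ≥ 1`, then
`K − N(T*) ≤ 3s + 5`, because the deficit satisfies `(T*/2π)log(T₀/T*) ≤ (T₀ − T*)/(2π)` (`log x ≤ x − 1`).
[this track, ATTEMPT-16 Lemma B1 (c)] -/
theorem sub_zetaZeroCount_horizon_le {b T₀ s Tstar : ℝ} {K : ℕ} (hb : 1 ≤ b) (hT₀ : T₀ = 2 * π * Real.exp (1 + 2 * b))
    (hK : Tstar = π * K / b) (hTpos : 0 < Tstar)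
    (hlow : Tstar / (2 * π) * Real.log (Tstar / (2 * π * Real.exp 1)) - s ≤ (zetaZeroCount Tstar : ℝ))
    (hT3 : T₀ - 4 * π * (s + 2) - 2 * π / b ≤ Tstar) :
    (K : ℝ) - zetaZeroCount Tstar ≤ 3 * s + 5 := by
  have hπ : 0 < π := Real.pi_pos
  have hb0 : 0 < b := by linarith
  have hT₀pos : 0 < T₀ := by rw [hT₀]; positivity
  rw [main_eq_lattice_sub_deficit (b := b) hTpos, ← hT₀] at hlow
  have hbt : b * Tstar / π = K := by rw [hK]; field_simp
  rw [hbt] at hlow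
  -- deficit(T*) ≤ (T₀ − T*)/(2π) ≤ 2(s+2) + 1/b ≤ 2s + 5
  have hlog : Real.log (T₀ / Tstar) ≤ T₀ / Tstar - 1 := Real.log_le_sub_one_of_pos (by positivity)
  have hdef : Tstar / (2 * π) * Real.log (T₀ / Tstar) ≤ (T₀ - Tstar) / (2 * π) := by
    have := mul_le_mul_of_nonneg_left hlog (show 0 ≤ Tstar / (2 * π) by positivity)
    have h2 : Tstar / (2 * π) * (T₀ / Tstar - 1) = (T₀ - Tstar) / (2 * π) := by
      field_simp
    linarith [h2.le, h2.symm.le]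
  have hgap : (T₀ - Tstar) / (2 * π) ≤ 2 * (s + 2) + 1 / b := by
    rw [div_le_iff₀ (by positivity)]
    have : 1 / b * (2 * π) = 2 * π / b := by ring
    nlinarith [this]
  have h1b : 1 / b ≤ 1 := by rw [div_le_one hb0]; exact hb
  linarith

/-- **Lemma B1 (a) with the tree's explicit counting theorem.** With `s := 0.1038·log T₀ + 0.2573·log log T₀ + 9.3675`
(`zetaZeroCount_hasanalizade_shen_wong_holds`), the hypothesis `hs` of `zetaZeroCount_lattice_le` holds for `14 ≤ t ≤ T₀`; hence under the
undershoot `T* ≤ T₀ − 4π(s+2)`, `T₀ ≤ (11/10)T*`, `(14/2π)log(T₀/14) ≥ s+1`: `N(πk/b) ≤ k − 1` for all `k ≥ 1` with `πk/b ≤ T*`.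
[this track, ATTEMPT-16 Lemma B1 (a); counting input `zetaZeroCount_hasanalizade_shen_wong_holds`] -/
theorem zetaZeroCount_lattice_le_hsw {b T₀ Tstar : ℝ} (hb : 1 ≤ b) (hT₀ : T₀ = 2 * π * Real.exp (1 + 2 * b))
    (hT1 : Tstar ≤ T₀ - 4 * π * ((0.1038 * Real.log T₀ + 0.2573 * Real.log (Real.log T₀) + 9.3675) + 2))
    (hT2 : T₀ ≤ 11 / 10 * Tstar)
    (hQ1b : (0.1038 * Real.log T₀ + 0.2573 * Real.log (Real.log T₀) + 9.3675) + 1 ≤ 14 / (2 * π) * Real.log (T₀ / 14))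
    {k : ℕ} (hk : 1 ≤ k) (hkT : π * k / b ≤ Tstar) :
    (zetaZeroCount (π * k / b) : ℝ) ≤ k - 1 := by
  set s : ℝ := 0.1038 * Real.log T₀ + 0.2573 * Real.log (Real.log T₀) + 9.3675 with hs_def
  have hπ3 : 3 < π := Real.pi_gt_three
  -- T₀ = 2π e^{1+2b} ≥ e, so log T₀ ≥ 1 and log log T₀ ≥ 0
  have hexp : Real.exp 1 ≤ Real.exp (1 + 2 * b) := Real.exp_le_exp.2 (by linarith)
  have hT₀e : Real.exp 1 ≤ T₀ := by
    rw [hT₀]; nlinarith [Real.exp_pos (1 + 2 * b), Real.exp_pos 1]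
  have hT₀pos : 0 < T₀ := lt_of_lt_of_le (Real.exp_pos 1) hT₀e
  have hlogT₀ : 1 ≤ Real.log T₀ := by
    rw [Real.le_log_iff_exp_le hT₀pos]; exact hT₀e
  have hllT₀ : 0 ≤ Real.log (Real.log T₀) := Real.log_nonneg hlogT₀
  have hs0 : 0 ≤ s := by rw [hs_def]; positivity
  refine zetaZeroCount_lattice_le hb hT₀ hs0 ?_ hT1 hT2 hQ1b hk hkT
  intro t h14 htT₀
  have ht0 : 0 < t := by linarith
  have hte : Real.exp 1 ≤ t := by have := Real.exp_one_lt_d9; linarith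
  have hHSW := zetaZeroCount_hasanalizade_shen_wong_holds t hte
  have hA := (abs_le.1 hHSW).2
  -- monotonicity of the explicit error in t ≤ T₀
  have hlogt : 1 ≤ Real.log t := by rw [Real.le_log_iff_exp_le ht0]; exact hte
  have hlog_le : Real.log t ≤ Real.log T₀ := Real.log_le_log ht0 htT₀
  have hll_le : Real.log (Real.log t) ≤ Real.log (Real.log T₀) := Real.log_le_log (by linarith) hlog_le
  have : 0.1038 * Real.log t + 0.2573 * Real.log (Real.log t) + 9.3675 ≤ s := by
    rw [hs_def]; nlinarith
  linarith

end Summit.RiemannHypothesis.RiemannHypothesis.Theorems.Handoff
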